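import Summits.Ventures.YMGap.FlowData.RectTubeTranslations
import Summits.Ventures.YMGap.FlowData.RectTubeFluxNonAnnihilation
import HarnessLib

/-!
# Venture YMGap, track Y3 FLOW-DATA — rectangular tubes: OFFSET Polyakov lines, the parity character of `ℤ/L`, and the
# matrix element `⟪ψ, Tψ⟫ = C ∫ W̃²` of a REPRODUCING gauge-invariant state (theorems only; file 1/2)

HONEST FRAMING: venture file of the cell `pub-ymgap` (QuantumFields programme), track Y3; companion THEOREMS for the
definitions of `FlowData/RectTubeTranslations.lean`, preparing file 2/2 (`FlowData/RectTubeMomentumPiStates.lean`: no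
`(ê_μ, π_ν)` sector is annihilated; `Δ_p ≥ 0`).  Finite rectangular torus `Π_i ℤ/(Ls i)`; no number, no row, nothing about
`L → ∞`, the continuum or a mass gap.

* `rectMagSum_translate` — spatial plaquettes are translation invariant;
* `rectOffsetLine_injective`, `prod_ofFn_rectOffsetLine_gauge`, `prod_ofFn_rectOffsetLine_fluxTwist`,
  `prod_ofFn_rectOffsetLine_translate` — the straight `μ`-line at transverse offset `j ê_ν` (`ν ≠ μ`),
  `t ↦ (t ê_μ + j ê_ν, μ)`: distinct links, holonomy conjugated by gauge transformations (by `γ(j ê_ν)`), one factor `z`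
  under a twist of the direction `μ`, and a translation by `i ê_ν` shifts the offset to `j + i`;
* `zmodParitySign_neg`, `sum_zmodParitySign_eq_zero` — `(−1)^{−j} = (−1)^j` and `Σ_{j ∈ ℤ/L} (−1)^j = 0` for even `L`;
* **`inner_rectTubeTransferOperator_reproducingState`** — `⟪ψ, Tψ⟫ = C ∫ W̃²` for `ψ = e^{−J mag/2} W̃` whenever `W̃` is
  continuous, gauge invariant and reproduced by the one-step Haar chain with factor `C`
  (`∫ ∏_e e^{J Re tr ρ(c_e)} W̃(c·a) dc = C · W̃(a)`; the temporal links gauge away,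
  `RectTubePolyakovLine.integral_integral_exp_rectElecSum_mul`).

References: G. 't Hooft, Nucl. Phys. B 153 (1979) 141 [cite: tHooft1979Flux]; I. Montvay, G. Münster (1994) §3.2.6
[cite: MontvayMunster1994, §3.2.6].
-/

noncomputable section

open scoped BigOperators ENNReal
open MeasureTheory Filter Function
open Literature.MathematicalPhysics.QuantumFieldTheory Literature.Analysis.OperatorTheory
open Literature.MathematicalPhysics.QuantumLattice (RectTorusSite)

namespace Summit.Ventures.YMGap.FlowData

/-! ### Translation invariance of the spatial plaquette sum -/

section MagSum

variable {G : Type*} [Group G] {n k : ℕ} (ρ : G →* Matrix (Fin n) (Fin n) ℂ) {Ls : Fin k → ℕ} [∀ i, NeZero (Ls i)]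

/-- **Spatial plaquettes are translation invariant**: `mag(τ_v a) = mag(a)` (re-index the site sum by `x ↦ x + v`).
[folklore] -/
theorem rectMagSum_translate (v : RectTorusSite Ls) (a : RectSlice Ls G) :
    rectMagSum ρ (rectTranslate v a) = rectMagSum ρ a := by
  unfold rectMagSum
  conv_rhs => rw [← Equiv.sum_comp (Equiv.addRight v)]
  refine Finset.sum_congr rfl fun x _ => Finset.sum_congr rfl fun p _ => ?_
  simp only [rectTranslate_apply, Equiv.coe_addRight, add_right_comm x v]

end MagSum

/-! ### The straight `μ`-line at transverse offset `j ê_ν` -/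

section OffsetLine

variable {G : Type*} [Group G] {k : ℕ} {Ls : Fin k → ℕ} [∀ i, NeZero (Ls i)]

omit [∀ i, NeZero (Ls i)] in
/-- The `μ`-coordinate of the offset base point `t ê_μ + j ê_ν` (`ν ≠ μ`) is `t`. [folklore] -/
theorem rectOffsetLine_coord {μ ν : Fin k} (hμν : μ ≠ ν) (t : ZMod (Ls μ)) (j : ZMod (Ls ν)) :
    ((Pi.single μ t + Pi.single ν j : RectTorusSite Ls) μ) = t := by
  rw [Pi.add_apply, Pi.single_eq_same, Pi.single_eq_of_ne hμν, add_zero]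

omit [∀ i, NeZero (Ls i)] in
/-- The offset line consists of distinct links. [folklore] -/
theorem rectOffsetLine_injective {μ ν : Fin k} (hμν : μ ≠ ν) (j : ZMod (Ls ν)) :
    Injective fun t : Fin (Ls μ) =>
      ((Pi.single μ ((t : ℕ) : ZMod (Ls μ)) + Pi.single ν j, μ) : RectTorusSite Ls × Fin k) := by
  intro t t' h
  have h1 : ((t : ℕ) : ZMod (Ls μ)) = ((t' : ℕ) : ZMod (Ls μ)) := by
    have := congrArg (fun e : RectTorusSite Ls × Fin k => e.1 μ) h
    simpa only [rectOffsetLine_coord hμν] using this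
  rw [ZMod.natCast_eq_natCast_iff'] at h1
  rw [Nat.mod_eq_of_lt t.2, Nat.mod_eq_of_lt t'.2] at h1
  exact Fin.ext h1

omit [∀ i, NeZero (Ls i)] in
/-- Consecutive base points of the offset line. [folklore] -/
theorem rectOffsetLineSite_shift (μ ν : Fin k) (j : ZMod (Ls ν)) (t : ℕ) :
    (Pi.single μ ((t : ℕ) : ZMod (Ls μ)) + Pi.single ν j : RectTorusSite Ls) + Pi.single μ 1 =
      Pi.single μ (((t + 1 : ℕ) : ℕ) : ZMod (Ls μ)) + Pi.single ν j := by
  rw [add_right_comm, ← Pi.single_add, Nat.cast_add, Nat.cast_one]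

omit [∀ i, NeZero (Ls i)] in
/-- **A gauge transformation conjugates the offset-line holonomy** (by `γ(j ê_ν)`). [folklore] -/
theorem prod_ofFn_rectOffsetLine_gauge (μ ν : Fin k) (j : ZMod (Ls ν)) (γ : RectTorusSite Ls → G) (a : RectSlice Ls G) :
    (List.ofFn fun t : Fin (Ls μ) => (fun e : RectTorusSite Ls × Fin k => γ e.1 * a e * (γ (e.1 + Pi.single e.2 1))⁻¹)
        (Pi.single μ ((t : ℕ) : ZMod (Ls μ)) + Pi.single ν j, μ)).prod =
      γ (Pi.single ν j) * (List.ofFn fun t : Fin (Ls μ) => a (Pi.single μ ((t : ℕ) : ZMod (Ls μ)) + Pi.single ν j, μ)).prod *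
        (γ (Pi.single ν j))⁻¹ := by
  have h := prod_ofFn_telescope (Ls μ) (fun t => γ (Pi.single μ ((t : ℕ) : ZMod (Ls μ)) + Pi.single ν j))
    (fun t => a (Pi.single μ ((t : ℕ) : ZMod (Ls μ)) + Pi.single ν j, μ))
  simp only [rectOffsetLineSite_shift]
  rw [h]
  simp only [Nat.cast_zero, Pi.single_zero, ZMod.natCast_self, zero_add]

omit [∀ i, NeZero (Ls i)] in
/-- On the offset line the twist prefactor is `z` exactly on the link `t = 0` of a twisted direction (`ν ≠ μ`).
[folklore] -/
theorem rectFluxTwistPrefactor_offsetLine {μ ν : Fin k} (hμν : μ ≠ ν) (z : G) (s : Fin k → ZMod 2) (j : ZMod (Ls ν))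
    (t : Fin (Ls μ)) :
    rectFluxTwistPrefactor (Ls := Ls) z s (Pi.single μ ((t : ℕ) : ZMod (Ls μ)) + Pi.single ν j, μ) =
      if s μ = 1 ∧ (t : ℕ) = 0 then z else 1 := by
  unfold rectFluxTwistPrefactor
  simp only [rectOffsetLine_coord hμν]
  have h : (((t : ℕ) : ZMod (Ls μ)) = 0) ↔ (t : ℕ) = 0 := by
    rw [ZMod.natCast_eq_zero_iff]
    exact ⟨fun hd => Nat.eq_zero_of_dvd_of_lt hd t.2, fun h0 => by rw [h0]; exact dvd_zero _⟩
  simp only [h]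

/-- **The centre twist multiplies the offset-line holonomy by one factor `z`** iff the line's direction is twisted.
[cite: tHooft1979Flux] -/
theorem prod_ofFn_rectOffsetLine_fluxTwist {μ ν : Fin k} (hμν : μ ≠ ν) (z : G) (s : Fin k → ZMod 2) (j : ZMod (Ls ν))
    (a : RectSlice Ls G) :
    (List.ofFn fun t : Fin (Ls μ) => rectFluxTwist z s a (Pi.single μ ((t : ℕ) : ZMod (Ls μ)) + Pi.single ν j, μ)).prod =
      (if s μ = 1 then z else 1) *
        (List.ofFn fun t : Fin (Ls μ) => a (Pi.single μ ((t : ℕ) : ZMod (Ls μ)) + Pi.single ν j, μ)).prod := by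
  simp only [rectFluxTwist_apply, rectFluxTwistPrefactor_offsetLine hμν]
  exact prod_ofFn_ite_zero_mul (Ls μ) z (s μ = 1) _

omit [∀ i, NeZero (Ls i)] in
/-- **A translation along `ν` shifts the offset**: the holonomy of the line at offset `j` in the translated
configuration `τ_{iê_ν} a` is the holonomy of the line at offset `j + i` in `a`. [folklore] -/
theorem prod_ofFn_rectOffsetLine_translate (μ ν : Fin k) (i j : ZMod (Ls ν)) (a : RectSlice Ls G) :
    (List.ofFn fun t : Fin (Ls μ) =>
        rectTranslate (Pi.single ν i) a (Pi.single μ ((t : ℕ) : ZMod (Ls μ)) + Pi.single ν j, μ)).prod =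
      (List.ofFn fun t : Fin (Ls μ) => a (Pi.single μ ((t : ℕ) : ZMod (Ls μ)) + Pi.single ν (j + i), μ)).prod := by
  have h : (fun t : Fin (Ls μ) =>
      rectTranslate (Pi.single ν i) a (Pi.single μ ((t : ℕ) : ZMod (Ls μ)) + Pi.single ν j, μ)) =
      fun t : Fin (Ls μ) => a (Pi.single μ ((t : ℕ) : ZMod (Ls μ)) + Pi.single ν (j + i), μ) := by
    funext t
    rw [rectTranslate_apply, add_assoc, ← Pi.single_add]
  rw [h]

end OffsetLine

/-! ### Signs: `Σ_j (−1)^j = 0` on `ℤ/L` for even `L` -/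

section Signs

/-- `(−1)^{−j} = (−1)^j` on `ℤ/L`, `L` even. [folklore] -/
theorem zmodParitySign_neg {L : ℕ} [NeZero L] (hL : Even L) (j : ZMod L) :
    zmodParitySign (-j) = zmodParitySign j := by
  have h := zmodParitySign_add hL j (-j)
  rw [add_neg_cancel, zmodParitySign_zero] at h
  have hj := zmodParitySign_mul_self j
  -- `1 = ε_j ε_{-j}` and `ε_j ε_j = 1` ⇒ `ε_{-j} = ε_j`
  nlinarith [hj, h, sq_nonneg (zmodParitySign j - zmodParitySign (-j))]

/-- **`Σ_{j ∈ ℤ/L} (−1)^j = 0` for even `L ≥ 2`** (`S = Σ_j (−1)^{j+1} = −S`). [folklore] -/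
theorem sum_zmodParitySign_eq_zero {L : ℕ} [NeZero L] (hL : Even L) (h2 : 2 ≤ L) :
    ∑ j : ZMod L, zmodParitySign j = 0 := by
  haveI : Fact (1 < L) := ⟨h2⟩
  have h1 : zmodParitySign (1 : ZMod L) = -1 := by
    rw [zmodParitySign, ZMod.val_one, pow_one]
  have h : ∑ j : ZMod L, zmodParitySign j = ∑ j : ZMod L, zmodParitySign (j + 1) :=
    (Equiv.sum_comp (Equiv.addRight (1 : ZMod L)) (fun j => zmodParitySign j)).symm
  have h' : ∑ j : ZMod L, zmodParitySign (j + 1) = -∑ j : ZMod L, zmodParitySign j := by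
    rw [← Finset.sum_neg_distrib]
    refine Finset.sum_congr rfl fun j _ => ?_
    rw [zmodParitySign_add hL, h1, mul_neg_one]
  linarith [h.trans h']

end Signs

/-! ### Matrix element of a reproducing gauge-invariant state -/

section Reproducing

variable {G : Type*} [Group G] [TopologicalSpace G] [IsTopologicalGroup G] [CompactSpace G]
  [MeasurableSpace G] [BorelSpace G] [SecondCountableTopology G] {n k : ℕ} (ρ : G →* Matrix (Fin n) (Fin n) ℂ)
  (J : ℝ) {Ls : Fin k → ℕ} [∀ i, NeZero (Ls i)]

/-- **`⟪ψ, Tψ⟫ = C ∫ W̃²`** for `ψ = e^{−J mag/2} W̃` whenever `W̃` is continuous, gauge invariant and REPRODUCED by the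
one-step Haar chain, `∫ (∏_e e^{J Re tr ρ(c_e)}) W̃(c·a) dc = C · W̃(a)` (the temporal links gauge away:
`RectTubePolyakovLine.integral_integral_exp_rectElecSum_mul`). [cite: MontvayMunster1994, §3.2.6] -/
theorem inner_rectTubeTransferOperator_reproducingState (hρ : Continuous ρ) {W : RectSlice Ls G → ℝ} (hWc : Continuous W)
    (hWg : ∀ (γ : RectTorusSite Ls → G) (b : RectSlice Ls G),
      W (fun e => γ e.1 * b e * (γ (e.1 + Pi.single e.2 1))⁻¹) = W b)
    {C : ℝ} (hrep : ∀ a : RectSlice Ls G,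
      ∫ c, (∏ e : RectTorusSite Ls × Fin k, Real.exp (J * (ρ (c e)).trace.re)) * W (c * a) ∂(rectSliceMeasure G Ls) =
        C * W a)
    (hmem : MemLp (fun b : RectSlice Ls G => Real.exp (-(J / 2 * rectMagSum (Ls := Ls) ρ b)) * W b) 2 (rectSliceMeasure G Ls)) :
    @inner ℝ _ _ (hmem.toLp _) (rectTubeTransferOperator ρ J Ls (hmem.toLp _)) =
      C * ∫ b, W b ^ 2 ∂(rectSliceMeasure G Ls) := by
  set f : RectSlice Ls G → ℝ := fun b => Real.exp (-(J / 2 * rectMagSum (Ls := Ls) ρ b)) * W b with hf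
  set ψ : Lp ℝ 2 (rectSliceMeasure G Ls) := hmem.toLp _ with hψ
  rw [inner_kernelOp_eq_integral (rectTubeTransferOperator_ae_eq J Ls hρ) ψ ψ]
  have hae : (ψ : RectSlice Ls G → ℝ) =ᵐ[rectSliceMeasure G Ls] f := hmem.coeFn_toLp
  have h1 : ∀ a, ∫ b, rectSliceKernel (Ls := Ls) ρ J J a b * ψ b ∂(rectSliceMeasure G Ls) =
      ∫ b, rectSliceKernel (Ls := Ls) ρ J J a b * f b ∂(rectSliceMeasure G Ls) := by
    intro a
    refine integral_congr_ae ?_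
    filter_upwards [hae] with b hb
    rw [hb]
  have h2 : (fun a => ψ a * ∫ b, rectSliceKernel (Ls := Ls) ρ J J a b * ψ b ∂(rectSliceMeasure G Ls))
      =ᵐ[rectSliceMeasure G Ls]
      fun a => f a * ∫ b, rectSliceKernel (Ls := Ls) ρ J J a b * f b ∂(rectSliceMeasure G Ls) := by
    filter_upwards [hae] with a ha
    rw [ha, h1 a]
  rw [integral_congr_ae h2]
  -- the inner integral
  have h3 : ∀ a, ∫ b, rectSliceKernel (Ls := Ls) ρ J J a b * f b ∂(rectSliceMeasure G Ls) =
      Real.exp (J / 2 * rectMagSum (Ls := Ls) ρ a) * (C * W a) := by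
    intro a
    have hK : ∀ b, rectSliceKernel (Ls := Ls) ρ J J a b * f b = Real.exp (J / 2 * rectMagSum (Ls := Ls) ρ a) *
        ((∫ E, Real.exp (J * rectElecSum (Ls := Ls) ρ a E b)
          ∂(Measure.pi fun _ : RectTorusSite Ls => haarProbability G)) * W b) := by
      intro b
      simp only [rectSliceKernel, hf, Real.exp_neg]
      field_simp
    simp_rw [hK]
    rw [integral_const_mul, integral_integral_exp_rectElecSum_mul ρ J hρ hWc hWg a, hrep a]
  simp_rw [h3]
  have h5 : ∀ a, f a * (Real.exp (J / 2 * rectMagSum (Ls := Ls) ρ a) * (C * W a)) = C * W a ^ 2 := by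
    intro a
    simp only [hf, Real.exp_neg]
    field_simp
  simp_rw [h5]
  rw [integral_const_mul]

end Reproducing

end Summit.Ventures.YMGap.FlowData
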